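import Literature.AlgebraicGeometry.HodgeTheory.GysinFormalismCorrespondences
import Literature.AlgebraicGeometry.HodgeTheory.ZariskiClosedNowhereDense
import Literature.AlgebraicGeometry.HodgeTheory.HypersurfaceLefschetzIntegral
import Literature.AlgebraicGeometry.HodgeTheory.HolomorphicBundleChernCharacterProjectiveSpace
import Literature.AlgebraicGeometry.Motives.AbelianVarietyComplexPoints
import Literature.AlgebraicGeometry.Motives.Sweep1
import Literature.AlgebraicTopology.SingularHomology.CohomologyOfPoint
import Literature.NumberTheory.Transcendental.AnalytificationProjProofs
import Literature.AlgebraicGeometry.Motives.AbelianVarietyRationalCurves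

/-!
# `X × ℙ¹ × ℙ¹` is never an anchor: not a Fermat variety, not an abelian variety

Route `PadicSemiregularLift` of `HodgeConjecture`, support item `HodgeBeyondAnchors`
(stmt-HodgeConjecture-14054), which asserts the Hodge conjecture for every smooth projective `X/ℂ`
that is NOT an anchor: not the underlying scheme `A.X` of an abelian variety, and not a Fermat
hypersurface `V₊(x₀ᵐ + ⋯ + x_{N+1}ᵐ) ⊂ ℙᴺ⁺¹` (`Motives.IsFermatVariety`). This helper file shows
that the class of non-anchors is large enough to dominate everything: for `X` smooth projective of
dimension `n` and a smooth projective curve `C`,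

* `not_isFermatVariety_tensor_tensor` — **`(X ⊗ C) ⊗ C` is not a Fermat variety** (`n ≥ 1`, `C`
  with a non-zero class in `H²(C(ℂ); ℂ)`, e.g. `ℙ¹`): a Fermat variety of dimension `n + 2 ≥ 3`
  is a smooth hypersurface in `ℙⁿ⁺³`, so by the Lefschetz hyperplane theorem — PROVED in the tree,
  `smoothHypersurface_map_surjective` (Voisin II Thm. 1.23, Andreotti–Frankel) — its `H²` is a
  quotient of the line `H²(ℙⁿ⁺³(ℂ); ℂ)`; but `pr₂^* h` and `pr₃^* h` are independent in
  `H²((X × C × C)(ℂ); ℂ)`, as restriction to the slices `{x} × C × {t}` and `{y} × C` shows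
  (a morphism factoring through `Spec ℂ` kills `H²`). The degenerate degree `m = 0` (`V₊(unit) = ∅`)
  is excluded by non-emptiness;
* `abelianVariety_X_ne_tensor_tensor` — **`(X ⊗ ℙ¹) ⊗ ℙ¹` is not `A.X` for any abelian variety
  `A`**, granted the tree's named fact
  `Literature.AlgebraicGeometry.Motives.Milne1986_projectiveLine_to_abelianVariety_const` (Milne,
  *Abelian Varieties*, §3 Cor. 3.8: every rational map `ℙ¹ → A` is constant; morphism form, on
  underlying points; relocated from this file's first submission, p81773): the slice `{y} × ℙ¹` is a non-constant morphism from `ℙ¹`.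

Consumer: `…HodgeBeyondAnchorsEquivalence` (`HodgeBeyondAnchors ↔ HodgeConjecture` modulo named
facts). The two degree-`0` Fermat lemmas are adapted from the disprover's workfile
`Cruxes/HodgeFermatVarieties/Disproof.lean` (refuter, 2026-08-16).

References: J. S. Milne, *Abelian Varieties*, in Cornell–Silverman, *Arithmetic Geometry* (1986),
§3 Cor. 3.8 (p. 107); C. Voisin, *Hodge Theory and Complex Algebraic Geometry II* (2003), §1.2.2
Thm. 1.23; A. Hatcher, *Algebraic Topology* (2002), §3.1 p. 199, Thm. 3.19; R. Hartshorne,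
*Algebraic Geometry* (1977), II Ex. 2.14.
-/

set_option linter.dupNamespace false

noncomputable section

open CategoryTheory AlgebraicGeometry MonoidalCategory CartesianMonoidalCategory Topology Limits
open Literature.AlgebraicTopology.SingularHomology
open Literature.AlgebraicGeometry Literature.AlgebraicGeometry.HodgeTheory
  Literature.AlgebraicGeometry.Motives

namespace Summit.HodgeConjecture.HodgeConjecture.Theorems.HodgeBeyondAnchors

/-! ## Products with two projective lines are never anchors -/

section NotAnchors

/-! ### Slices of `(X ⊗ C) ⊗ C` and classes pulled back from the two curve factors -/

variable {n : ℕ} {X C : SchemeOver ℂ}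

/-- `Spec ℂ(ℂ)` is a single point. [folklore] -/
theorem toSpecOver_specOver : toSpecOver (specOver ℂ ℂ) = 𝟙 _ := by
  apply Over.OverMorphism.ext
  rw [toSpecOver_left]
  change Spec.map (CommRingCat.ofHom (algebraMap ℂ ℂ)) = 𝟙 (Spec (CommRingCat.of ℂ))
  rw [Algebra.algebraMap_self, CommRingCat.ofHom_id, Spec.map_id]

/-- `Spec ℂ` has exactly one complex point. [folklore] -/
theorem subsingleton_complexPoints_specOver : Subsingleton (ComplexPoints (specOver ℂ ℂ)) := by
  refine ⟨fun P Q ↦ ?_⟩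
  have hP := AlgPoints.self_comp_toSpecOver P
  have hQ := AlgPoints.self_comp_toSpecOver Q
  rw [toSpecOver_specOver, Category.comp_id] at hP hQ
  rw [hP, hQ]

/-- `Hᵏ(pt; ℂ) = 0` for `k ≠ 0`. [cite: HatcherAT2002, §3.1 p. 199] -/
theorem isZero_complexBetti_specOver {k : ℕ} (hk : k ≠ 0) : IsZero (complexBetti (specOver ℂ ℂ) k) :=
  haveI := subsingleton_complexPoints_specOver
  singularCochainComplex.isZero_singularCohomology_of_subsingleton' hk

/-- A morphism factoring through the point `Spec ℂ` kills `Hᵏ`, `k ≠ 0`.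
[cite: HatcherAT2002, §3.1 p. 199] -/
theorem complexBetti_map_toSpecOver_comp {Y : SchemeOver ℂ} (y : ComplexPoints Y) {k : ℕ} (hk : k ≠ 0)
    (c : complexBetti Y k) : complexBetti.map (toSpecOver X ≫ y) k c = 0 := by
  rw [complexBetti.map_comp, CategoryTheory.comp_apply,
    (isZero_complexBetti_specOver hk).eq_zero_of_tgt (complexBetti.map y k)]
  simp

/-! The slice of the LAST factor at `y ∈ (X ⊗ C)(ℂ)` is `lift (toSpecOver C ≫ y) (𝟙 C) : C ⟶ (X ⊗ C) ⊗ C`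
(`c ↦ (y, c)`); the slice of the MIDDLE factor at `x ∈ X(ℂ)`, `t ∈ C(ℂ)` is
`lift (lift (toSpecOver C ≫ x) (𝟙 C)) (toSpecOver C ≫ t)` (`c ↦ ((x, c), t)`); the two classes are
`pr₃^* h = (snd (X ⊗ C) C)^* h` and `pr₂^* h = (fst (X ⊗ C) C ≫ snd X C)^* h`. No definitions are
introduced for them (proof file). -/

/-- `({y} × C)^* (pr₃^* h) = h`. [folklore] -/
theorem map_sliceLast_sndClass (y : ComplexPoints (X ⊗ C)) (h : complexBetti C 2) :
    complexBetti.map (lift (toSpecOver C ≫ y) (𝟙 C)) 2 (complexBetti.map (snd (X ⊗ C) C) 2 h) = h := by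
  rw [← CategoryTheory.comp_apply, ← complexBetti.map_comp, lift_snd, complexBetti.map_id]; rfl

/-- `({y} × C)^* (pr₂^* h) = 0` (the composite factors through a point). [folklore] -/
theorem map_sliceLast_midClass (y : ComplexPoints (X ⊗ C)) (h : complexBetti C 2) :
    complexBetti.map (lift (toSpecOver C ≫ y) (𝟙 C)) 2
      (complexBetti.map (fst (X ⊗ C) C ≫ snd X C) 2 h) = 0 := by
  rw [← CategoryTheory.comp_apply, ← complexBetti.map_comp, lift_fst_assoc, Category.assoc]
  exact complexBetti_map_toSpecOver_comp _ two_ne_zero h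

/-- `({x} × C × {t})^* (pr₂^* h) = h`. [folklore] -/
theorem map_sliceMid_midClass (x : ComplexPoints X) (t : ComplexPoints C) (h : complexBetti C 2) :
    complexBetti.map (lift (lift (toSpecOver C ≫ x) (𝟙 C)) (toSpecOver C ≫ t)) 2
      (complexBetti.map (fst (X ⊗ C) C ≫ snd X C) 2 h) = h := by
  rw [← CategoryTheory.comp_apply, ← complexBetti.map_comp, lift_fst_assoc, lift_snd,
    complexBetti.map_id]; rfl

/-- `({x} × C × {t})^* (pr₃^* h) = 0`. [folklore] -/
theorem map_sliceMid_sndClass (x : ComplexPoints X) (t : ComplexPoints C) (h : complexBetti C 2) :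
    complexBetti.map (lift (lift (toSpecOver C ≫ x) (𝟙 C)) (toSpecOver C ≫ t)) 2
      (complexBetti.map (snd (X ⊗ C) C) 2 h) = 0 := by
  rw [← CategoryTheory.comp_apply, ← complexBetti.map_comp, lift_snd]
  exact complexBetti_map_toSpecOver_comp _ two_ne_zero h

/-! ### Not a Fermat variety -/

/-- At `m = 0` the Fermat form is the non-zero constant `N + 2`, a unit.
(Adapted from the disprover's workfile `Cruxes/HodgeFermatVarieties/Disproof.lean`.) [folklore] -/
theorem isUnit_fermatPolynomial_degree_zero (N : ℕ) : IsUnit (fermatPolynomial ℂ N 0) := by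
  have h : fermatPolynomial ℂ N 0 = ((N + 2 : ℕ) : MvPolynomial (Fin (N + 2)) ℂ) := by
    simp only [fermatPolynomial, pow_zero, Finset.sum_const, Finset.card_univ, Fintype.card_fin,
      nsmul_eq_mul, mul_one]
  rw [h, ← map_natCast (algebraMap ℂ (MvPolynomial (Fin (N + 2)) ℂ))]
  refine IsUnit.map _ ?_
  rw [isUnit_iff_ne_zero]
  exact_mod_cast Nat.succ_ne_zero (N + 1)

/-- `IsFermatVariety N 0 Y` forces `Y = ∅` (`V₊(unit) = ∅`): no smooth projective `Y` is a Fermat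
variety of degree `0`. (Adapted from `Cruxes/HodgeFermatVarieties/Disproof.lean`.) [folklore] -/
theorem not_isFermatVariety_zero {N : ℕ} {Y : SchemeOver ℂ} (hY : IsSmoothProjective N Y) :
    ¬ IsFermatVariety N 0 Y := by
  letI := MvPolynomial.gradedAlgebra (σ := Fin (N + 1 + 1)) (R := ℂ)
  rintro ⟨_, ι, _, hrange⟩
  obtain ⟨P⟩ := HodgeTheory.nonempty_complexPoints hY
  have hx : ι.left.base P.pt ∈ Set.range ι.left.base := ⟨P.pt, rfl⟩
  rw [hrange] at hx
  have hx' : fermatPolynomial ℂ N 0 ∈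
      (ι.left.base P.pt : ProjectiveSpectrum
        (MvPolynomial.homogeneousSubmodule (Fin (N + 1 + 1)) ℂ)).asHomogeneousIdeal :=
    Set.singleton_subset_iff.1 ((ProjectiveSpectrum.mem_zeroLocus _ _ _).1 hx)
  exact (ι.left.base P.pt : ProjectiveSpectrum _).isPrime.ne_top
    (Ideal.eq_top_of_isUnit_mem _ hx' (isUnit_fermatPolynomial_degree_zero N))

/-- **`X × C × C` is not a Fermat variety** for `X` smooth projective of dimension `n ≥ 1` and `C` a
smooth projective curve carrying a non-zero class `h ∈ H²(C(ℂ); ℂ)`. If it were `V₊(Σ xᵢᵐ) ⊂ ℙⁿ⁺³`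
(`m ≥ 1`; `m = 0` is empty), the Lefschetz hyperplane theorem (PROVED in the tree,
`smoothHypersurface_map_surjective`: `ι^*` onto `H²` as `2 + 1 ≤ n + 2`) would make
`H²((X × C × C)(ℂ); ℂ)` a quotient of the line `H²(ℙⁿ⁺³(ℂ); ℂ)`; but `pr₂^* h`, `pr₃^* h` are
linearly independent, as the slices `{x} × C × {t}` and `{y} × C` show.
[cite: VoisinHodgeII2003, §1.2.2 Thm. 1.23] [cite: HatcherAT2002, Thm. 3.19] -/
theorem not_isFermatVariety_tensor_tensor (hX : IsSmoothProjective n X) (hn : 1 ≤ n)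
    (hC : IsSmoothProjective 1 C) {h : complexBetti C 2} (hh : h ≠ 0) (m : ℕ) :
    ¬ IsFermatVariety (n + 2) m ((X ⊗ C) ⊗ C) := by
  have hXC : IsSmoothProjective (n + 1) (X ⊗ C) := Motives.IsSmoothProjective.tensor_holds hX hC
  have hY : IsSmoothProjective (n + 1 + 1) ((X ⊗ C) ⊗ C) :=
    Motives.IsSmoothProjective.tensor_holds hXC hC
  rcases Nat.eq_zero_or_pos m with rfl | hm
  · exact not_isFermatVariety_zero hY
  letI := MvPolynomial.gradedAlgebra (σ := Fin (n + 2 + 1 + 1)) (R := ℂ)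
  rintro ⟨_, ι, hι, hrange⟩
  haveI := hι
  -- Lefschetz: `ι^*` is onto `H²`
  have hsurj := smoothHypersurface_map_surjective (R := ℂ) hY (isHomogeneous_fermatPolynomial (n + 2) m)
    hm ι hrange (k := 2) (by omega)
  -- a generator `g` of the line `H²(ℙⁿ⁺³(ℂ); ℂ)`
  have hfr : Module.finrank ℂ (complexBetti (projectiveSpace (n + 2 + 1) ℂ) (2 * 1)) = 1 :=
    finrank_complexBetti_projectiveSpace_two_mul_eq_one (n + 2 + 1) (by omega)
  obtain ⟨g, -, hg⟩ := finrank_eq_one_iff'.1 hfr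
  -- points for the slices
  obtain ⟨x⟩ := HodgeTheory.nonempty_complexPoints hX
  obtain ⟨t⟩ := HodgeTheory.nonempty_complexPoints hC
  obtain ⟨y⟩ := HodgeTheory.nonempty_complexPoints hXC
  -- `pr₂^* h = α e`, `pr₃^* h = β e` with `e = ι^* g`
  obtain ⟨a₁, ha₁⟩ := hsurj (complexBetti.map (fst (X ⊗ C) C ≫ snd X C) 2 h)
  obtain ⟨a₂, ha₂⟩ := hsurj (complexBetti.map (snd (X ⊗ C) C) 2 h)
  obtain ⟨α, rfl⟩ := hg a₁
  obtain ⟨β, rfl⟩ := hg a₂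
  rw [map_smul] at ha₁ ha₂
  by_cases hβ : β = 0
  · rw [hβ, zero_smul] at ha₂
    apply hh
    rw [← map_sliceLast_sndClass (X := X) y h, ← ha₂, map_zero]
  · apply hh
    have : complexBetti.map (fst (X ⊗ C) C ≫ snd X C) 2 h =
        (α * β⁻¹) • complexBetti.map (snd (X ⊗ C) C) 2 h := by
      rw [← ha₁, ← ha₂, smul_smul, mul_assoc, inv_mul_cancel₀ hβ, mul_one]
    rw [← map_sliceMid_midClass (X := X) x t h, this, map_smul, map_sliceMid_sndClass, smul_zero]

/-! ### Not an abelian variety -/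

open Literature.NumberTheory.Transcendental in
/-- `ℙ¹_ℂ` has two distinct points (`[1 : 0] ≠ [0 : 1]`). [cite: Hartshorne1977, II Ex. 2.14] -/
theorem exists_pt_ne_projectiveSpace_one :
    ∃ a b : ↥(projectiveSpace 1 ℂ).left, a ≠ b := by
  refine ⟨(projPoint 1 (Projectivization.mk ℂ ![1, 0] (by simp))).pt,
    (projPoint 1 (Projectivization.mk ℂ ![0, 1] (by simp))).pt, fun hab ↦ ?_⟩
  haveI := (isSmoothProjective_projectiveSpace_holds ℂ 1).smoothOfRelativeDimension
  haveI : Smooth (projectiveSpace 1 ℂ).hom := SmoothOfRelativeDimension.smooth 1 _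
  have := projPoint_injective 1 (Motives.ComplexPoints.ext_of_pt_eq hab)
  rw [Projectivization.mk_eq_mk_iff] at this
  obtain ⟨u, hu⟩ := this
  have h0 := congr_fun hu 0
  simp only [Pi.smul_apply, Matrix.cons_val_zero, Units.smul_def, smul_eq_mul, mul_zero] at h0
  exact one_ne_zero h0.symm

/-- **`X × ℙ¹ × ℙ¹` is not (the underlying scheme of) an abelian variety**, for `X` smooth
projective over `ℂ`, granted Milne's Cor. 3.8: the slice `{y} × ℙ¹ → X × ℙ¹ × ℙ¹` is a
non-constant morphism from `ℙ¹`. [cite: Milne1986AbelianVarieties, §3 Cor. 3.8 (p. 107)] -/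
theorem abelianVariety_X_ne_tensor_tensor (hconst : Milne1986_projectiveLine_to_abelianVariety_const.{0})
    (hX : IsSmoothProjective n X) (A : AbelianVariety ℂ) :
    A.X ≠ (X ⊗ projectiveSpace 1 ℂ) ⊗ projectiveSpace 1 ℂ := by
  obtain ⟨AX, hp, hgi⟩ := A
  rintro (rfl : AX = _)
  have hL : IsSmoothProjective 1 (projectiveSpace 1 ℂ) := isSmoothProjective_projectiveSpace_holds ℂ 1
  obtain ⟨y⟩ := HodgeTheory.nonempty_complexPoints (Motives.IsSmoothProjective.tensor_holds hX hL)
  obtain ⟨a, b, hab⟩ := exists_pt_ne_projectiveSpace_one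
  apply hab
  have h := hconst ℂ ⟨(X ⊗ projectiveSpace 1 ℂ) ⊗ projectiveSpace 1 ℂ, hp, hgi⟩
    (lift (toSpecOver _ ≫ y) (𝟙 (projectiveSpace 1 ℂ))) a b
  have hretr : ∀ c, (snd (X ⊗ projectiveSpace 1 ℂ) (projectiveSpace 1 ℂ)).left.base
      ((lift (toSpecOver _ ≫ y) (𝟙 (projectiveSpace 1 ℂ))).left.base c) = c := by
    intro c
    have h2 : (lift (toSpecOver _ ≫ y) (𝟙 (projectiveSpace 1 ℂ)) ≫ snd _ _).left.base c = c := by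
      rw [lift_snd]; rfl
    simpa only [Over.comp_left, Scheme.Hom.comp_base, TopCat.coe_comp, Function.comp_apply] using h2
  rw [← hretr a, ← hretr b]
  exact congrArg _ h

end NotAnchors

end Summit.HodgeConjecture.HodgeConjecture.Theorems.HodgeBeyondAnchors

end
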